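import Mathlib
import Literature.Computability.Complexity.CliqueTestGraphs
import Summits.PneNP.PneNP.Theorems.ConvexRankGatesConvexGateBlindBlocks
import Summits.PneNP.PneNP.Theorems.ConvexRankGatesConvexGateBlindFactorisation
import Summits.PneNP.PneNP.Theorems.ConvexRankGatesConvexGateBlindConverse
import Summits.PneNP.PneNP.Theorems.ConvexRankGatesConvexGateBlindOneGate

/-!
# PneNP / ConvexRankGates — `ConvexGateBlind`: the rank (matrix) form of the single-gate crux

Helpers (`--supports stmt-PneNP-10680`). Putting `convGate_certificate_factorisation`
(`…Factorisation.lean`) and `exists_convData_of_factorisation` (`…Converse.lean`) together: the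
asymptotic statement "for some `δ ∈ (0, 1/2)` and every `c`, eventually NO CONV data with
`p + q ≤ m^c` compute `CLIQUE(m, ⌈m^δ⌉₊)` exactly" (the single-gate / data form of the crux, to which the
circuit form collapses) is EQUIVALENT to the pure matrix statement "for some `δ ∈ (0, 1/2)` and every
`c`, eventually NO valid certificate system for the `⌈m^δ⌉₊`-clique-free graphs — non-negative edge
weightings `w_u` with thresholds `θ_u > w_u · u` — has its slack matrix against the `⌈m^δ⌉₊`-cliques
factorised through `PSD_q × ℝ^r_{≥0}` with `q + r ≤ m^c`" (`convDataHard_iff_rankHard`). The sizes are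
polynomially related (`q + (p + 1)` one way, `O(#E + q² + r)` the other), which the `∀ c` absorbs.
With the collapse (`convexGateBlind_iff_oneGate`, `…OneGate.lean`) and the absorption of the wiring into the input
coefficients (`oneGateHard_iff_dataHard`), the ROUTE DECL itself is equivalent to the matrix statement:
`convexGateBlind_iff_rankHard : ConvexGateBlind ↔ …`. Also: `trace_mul_nonneg_of_posSemidef` (`tr(H Z) ≥ 0` for
PSD `H, Z`, via the Schur product theorem). [folklore: Yannakakis 1991; Gouveia–Parrilo–Thomas 2013; Hrubeš 2020, Thm. 20]
-/

namespace Summit.PneNP.PneNP.Theorems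

open Matrix Finset Literature.Computability.Complexity
open scoped MatrixOrder

/-- `tr(H Z) ≥ 0` for positive semidefinite `H, Z` (the Frobenius pairing of the PSD cone with itself):
`tr(H Z) = 𝟙ᵀ (H ⊙ Zᵀ) 𝟙` and the Hadamard product of PSD matrices is PSD (Schur). [folklore] -/
theorem trace_mul_nonneg_of_posSemidef {q : ℕ} {H Z : Matrix (Fin q) (Fin q) ℝ} (hH : H.PosSemidef)
    (hZ : Z.PosSemidef) : 0 ≤ (H * Z).trace := by
  have hZt : Zᵀ.PosSemidef := hZ.transpose
  have hhad := (hH.hadamard hZt).dotProduct_mulVec_nonneg (fun _ => 1)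
  have h : star (fun _ : Fin q => (1 : ℝ)) ⬝ᵥ ((H ⊙ Zᵀ) *ᵥ fun _ => 1) = (H * Z).trace := by
    simp only [dotProduct, mulVec, Pi.star_apply, star_trivial, one_mul, mul_one, Matrix.hadamard_apply,
      Matrix.transpose_apply, Matrix.trace, Matrix.diag_apply, Matrix.mul_apply]
  rw [h] at hhad
  exact hhad

/-- **The single-gate crux in matrix form.** "Eventually no CONV data of size `m^c` compute
`CLIQUE(m, ⌈m^δ⌉₊)`" (for some `δ ∈ (0,1/2)`, every `c`) `↔` "eventually no valid certificate system for
the `⌈m^δ⌉₊`-clique-free graphs has a `PSD_q × ℝ^r_{≥0}` factorisation of its slack matrix against the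
`⌈m^δ⌉₊`-cliques with `q + r ≤ m^c`" (for some `δ ∈ (0,1/2)`, every `c`). Forward: a factorisation of
size `m^c` gives CONV data of size `≤ m^{2c+3}` (`exists_convData_of_factorisation` + re-indexing);
backward: CONV data of size `m^c` give a factorisation of size `≤ m^{c+1}`
(`convGate_certificate_factorisation`). [folklore assembly] -/
theorem convDataHard_iff_rankHard :
    (∃ δ : ℝ, 0 < δ ∧ δ < 1 / 2 ∧ ∀ c : ℕ, ∀ᶠ m : ℕ in Filter.atTop,
      ∀ (p q : ℕ), p + q ≤ m ^ c →
        ∀ (A : Fin p → Matrix (Fin q) (Fin q) ℝ) (b : Fin p → ℝ)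
          (B : Fin p → (⊤ : SimpleGraph (Fin m)).edgeSet → ℝ), (∀ i e, 0 ≤ B i e) →
          ¬ ∀ x : (⊤ : SimpleGraph (Fin m)).edgeSet → Bool, cliqueFn m ⌈(m : ℝ) ^ δ⌉₊ x = true ↔
            ∃ Y : Matrix (Fin q) (Fin q) ℝ, Y.PosSemidef ∧
              ∀ i, (A i * Y).trace ≤ b i + ∑ e, B i e * (if x e then (1 : ℝ) else 0)) ↔
    (∃ δ : ℝ, 0 < δ ∧ δ < 1 / 2 ∧ ∀ c : ℕ, ∀ᶠ m : ℕ in Filter.atTop,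
      ∀ (q r : ℕ), q + r ≤ m ^ c →
        ∀ (w : ((⊤ : SimpleGraph (Fin m)).edgeSet → Bool) → (⊤ : SimpleGraph (Fin m)).edgeSet → ℝ)
          (θ : ((⊤ : SimpleGraph (Fin m)).edgeSet → Bool) → ℝ)
          (H : ((⊤ : SimpleGraph (Fin m)).edgeSet → Bool) → Matrix (Fin q) (Fin q) ℝ)
          (lam : ((⊤ : SimpleGraph (Fin m)).edgeSet → Bool) → Fin r → ℝ)
          (Y : Finset (Fin m) → Matrix (Fin q) (Fin q) ℝ) (s : Finset (Fin m) → Fin r → ℝ),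
          (∀ u, cliqueFn m ⌈(m : ℝ) ^ δ⌉₊ u = false → ∀ e, 0 ≤ w u e) →
          (∀ u, cliqueFn m ⌈(m : ℝ) ^ δ⌉₊ u = false →
            ∑ e, w u e * (if u e then (1 : ℝ) else 0) < θ u) →
          (∀ u, cliqueFn m ⌈(m : ℝ) ^ δ⌉₊ u = false → (H u).PosSemidef) →
          (∀ u, cliqueFn m ⌈(m : ℝ) ^ δ⌉₊ u = false → ∀ ℓ, 0 ≤ lam u ℓ) →
          (∀ Q : Finset (Fin m), Q.card = ⌈(m : ℝ) ^ δ⌉₊ → (Y Q).PosSemidef) →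
          (∀ Q : Finset (Fin m), Q.card = ⌈(m : ℝ) ^ δ⌉₊ → ∀ ℓ, 0 ≤ s Q ℓ) →
          ¬ ∀ (Q : Finset (Fin m)) (u : (⊤ : SimpleGraph (Fin m)).edgeSet → Bool),
              Q.card = ⌈(m : ℝ) ^ δ⌉₊ → cliqueFn m ⌈(m : ℝ) ^ δ⌉₊ u = false →
                ∑ e, w u e * (if cliqueVec Q e then (1 : ℝ) else 0) - θ u =
                  (H u * Y Q).trace + ∑ ℓ, lam u ℓ * s Q ℓ) := by
  classical
  constructor
  · -- forward: a small factorisation would give small CONV data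
    rintro ⟨δ, hδ0, hδ1, hhard⟩
    refine ⟨δ, hδ0, hδ1, fun c => ?_⟩
    filter_upwards [hhard (2 * c + 3), Filter.eventually_ge_atTop 12] with m hm hm12
    intro q r hqr w θ H lam Y s hw hrej hH hlam hY hs hfact
    set k := ⌈(m : ℝ) ^ δ⌉₊ with hk
    obtain ⟨R, instR, hcardR, A, b, B, hB, hiff⟩ := exists_convData_of_factorisation w θ H lam Y s hw hrej
      (fun u hu Z hZ => trace_mul_nonneg_of_posSemidef (hH u hu) hZ) hlam hY hs hfact
    -- re-index rows and the PSD variable by `Fin`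
    obtain ⟨A', b', B', hB', hiff'⟩ := conv_feasible_reindex A b B
    -- size bookkeeping: `#R + #(Fin q ⊕ (E ⊕ Fin r)) ≤ m^{2c+3}`
    have hn : Fintype.card (⊤ : SimpleGraph (Fin m)).edgeSet ≤ m ^ 2 := card_edgeSet_top_le m
    have hm1 : 1 ≤ m := by omega
    have hq : q ≤ m ^ c := by omega
    have hr : r ≤ m ^ c := by omega
    have h2 : m ^ 2 ≤ m ^ (2 * c + 2) := Nat.pow_le_pow_right hm1 (by omega)
    have hc' : m ^ c ≤ m ^ (2 * c + 2) := Nat.pow_le_pow_right hm1 (by omega)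
    have h2c : m ^ (2 * c) ≤ m ^ (2 * c + 2) := Nat.pow_le_pow_right hm1 (by omega)
    have h1 : 1 ≤ m ^ (2 * c + 2) := Nat.one_le_pow _ _ (by omega)
    have hqq : q * q ≤ m ^ (2 * c) := by
      calc q * q ≤ m ^ c * m ^ c := Nat.mul_le_mul hq hq
        _ = m ^ (2 * c) := by rw [← pow_add]; ring_nf
    have h12 : 12 * m ^ (2 * c + 2) ≤ m ^ (2 * c + 3) := by
      calc 12 * m ^ (2 * c + 2) = m ^ (2 * c + 2) * 12 := Nat.mul_comm _ _
        _ ≤ m ^ (2 * c + 2) * m := Nat.mul_le_mul_left _ hm12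
        _ = m ^ (2 * c + 3) := (pow_succ m (2 * c + 2)).symm
    have hj : Fintype.card (Fin q ⊕ ((⊤ : SimpleGraph (Fin m)).edgeSet ⊕ Fin r)) =
        q + (Fintype.card (⊤ : SimpleGraph (Fin m)).edgeSet + r) := by
      simp only [Fintype.card_sum, Fintype.card_fin]
    have hsize : Fintype.card R + Fintype.card (Fin q ⊕ ((⊤ : SimpleGraph (Fin m)).edgeSet ⊕ Fin r)) ≤
        m ^ (2 * c + 3) := by
      rw [hj]
      omega
    -- the forbidden CONV data
    refine hm _ _ hsize A' b' B' (fun i e => by rw [hB']; exact hB _ e) fun x => ?_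
    rw [hiff x]
    exact hiff' x
  · -- backward: small CONV data would give a small factorisation
    rintro ⟨δ, hδ0, hδ1, hhard⟩
    refine ⟨δ, hδ0, hδ1, fun c => ?_⟩
    filter_upwards [hhard (c + 1), Filter.eventually_ge_atTop 2] with m hm hm2
    intro p q hpq A b B hB hiff
    set k := ⌈(m : ℝ) ^ δ⌉₊ with hk
    obtain ⟨R, y, lam, w, θ, H, Y, s, t, -, -, -, -, hrej, hacc⟩ :=
      convGate_certificate_factorisation A b B hB
    have hsize : q + (p + 1) ≤ m ^ (c + 1) := by
      have : m ^ c + 1 ≤ m ^ (c + 1) := by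
        rw [pow_succ]
        have h1 : 1 ≤ m ^ c := Nat.one_le_pow _ _ (by omega)
        nlinarith
      omega
    -- rejected = clique-free, accepted ⊇ clique vectors
    have hrej' : ∀ u : (⊤ : SimpleGraph (Fin m)).edgeSet → Bool, cliqueFn m k u = false →
        ¬ ∃ Z : Matrix (Fin q) (Fin q) ℝ, Z.PosSemidef ∧
          ∀ i, (A i * Z).trace ≤ b i + ∑ e, B i e * (if u e then (1 : ℝ) else 0) := by
      intro u hu hZ
      have := (hiff u).2 hZ
      rw [hu] at this
      exact Bool.noConfusion this
    have hacc' : ∀ Q : Finset (Fin m), Q.card = k →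
        ∃ Z : Matrix (Fin q) (Fin q) ℝ, Z.PosSemidef ∧
          ∀ i, (A i * Z).trace ≤ b i + ∑ e, B i e * (if cliqueVec Q e then (1 : ℝ) else 0) :=
      fun Q hQ => (hiff _).1 (cliqueFn_cliqueVec hQ.ge)
    refine hm q (p + 1) hsize w θ H (fun u => Fin.lastCases (lam u) (fun i => y u i))
      (fun Q => Y (cliqueVec Q)) (fun Q => Fin.lastCases (t (cliqueVec Q)) (fun i => s (cliqueVec Q) i))
      (fun u hu => (hrej u (hrej' u hu)).2.2.1) (fun u hu => (hrej u (hrej' u hu)).2.2.2.2)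
      (fun u hu => (hrej u (hrej' u hu)).2.2.2.1) (fun u hu ℓ => ?_) (fun Q hQ => (hacc _ (hacc' Q hQ)).1)
      (fun Q hQ ℓ => ?_) (fun Q u hQ hu => ?_)
    · refine Fin.lastCases ?_ (fun i => ?_) ℓ
      · simpa using (hrej u (hrej' u hu)).2.1
      · simpa using (hrej u (hrej' u hu)).1 i
    · refine Fin.lastCases ?_ (fun i => ?_) ℓ
      · simpa using (hacc _ (hacc' Q hQ)).2.2.2.1
      · simpa using (hacc _ (hacc' Q hQ)).2.2.1 i
    · have h := (hacc _ (hacc' Q hQ)).2.2.2.2.2.2 u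
      rw [Fin.sum_univ_castSucc]
      simp only [Fin.lastCases_castSucc, Fin.lastCases_last]
      linarith

/-! ### Absorbing the wiring, and the crux itself in matrix form -/

/-- **Wiring is free.** One CONV gate of size parameter `S` wired to the edge variables computes
`CLIQUE(m, k)` iff some CONV data of size `S` on the edge set compute it: pull the input coefficients back
along `Fintype.equivFin`, resp. push them forward along the wiring (`B i e = ∑_{a : w a = e} B' i a ≥ 0`).
[folklore] -/
theorem oneGateHard_iff_dataHard (m k S : ℕ) :
    (∀ g : GateFn, IsConvGate S g → ∀ w : Fin g.1 → (⊤ : SimpleGraph (Fin m)).edgeSet,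
      ¬ ∀ x : (⊤ : SimpleGraph (Fin m)).edgeSet → Bool, g.2 (fun a => x (w a)) = cliqueFn m k x) ↔
    (∀ (p q : ℕ), p + q ≤ S →
      ∀ (A : Fin p → Matrix (Fin q) (Fin q) ℝ) (b : Fin p → ℝ)
        (B : Fin p → (⊤ : SimpleGraph (Fin m)).edgeSet → ℝ), (∀ i e, 0 ≤ B i e) →
        ¬ ∀ x : (⊤ : SimpleGraph (Fin m)).edgeSet → Bool, cliqueFn m k x = true ↔
          ∃ Y : Matrix (Fin q) (Fin q) ℝ, Y.PosSemidef ∧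
            ∀ i, (A i * Y).trace ≤ b i + ∑ e, B i e * (if x e then (1 : ℝ) else 0)) := by
  classical
  constructor
  · intro h p q hpq A b B hB hiff
    set eq := Fintype.equivFin (⊤ : SimpleGraph (Fin m)).edgeSet with heq
    -- the gate reading the edges in the order of `eq`
    let g : GateFn := ⟨Fintype.card (⊤ : SimpleGraph (Fin m)).edgeSet, fun v =>
      decide (∃ Y : Matrix (Fin q) (Fin q) ℝ, Y.PosSemidef ∧
        ∀ i, (A i * Y).trace ≤ b i + ∑ a, B i (eq.symm a) * (if v a then (1 : ℝ) else 0))⟩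
    have hg : IsConvGate S g :=
      ⟨p, q, hpq, A, b, fun i a => B i (eq.symm a), fun i a => hB i _, fun v => by simp [g]⟩
    refine h g hg eq.symm fun x => ?_
    have hsum : ∀ i, ∑ a, B i (eq.symm a) * (if x (eq.symm a) then (1 : ℝ) else 0) =
        ∑ e, B i e * (if x e then (1 : ℝ) else 0) := fun i =>
      Equiv.sum_comp eq.symm (fun e => B i e * (if x e then (1 : ℝ) else 0))
    show decide _ = cliqueFn m k x
    simp_rw [hsum]
    rw [Bool.eq_iff_iff, decide_eq_true_iff]
    exact (hiff x).symm
  · rintro h g ⟨p, q, hpq, A, b, B', hB', hiff⟩ w hcomp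
    let B : Fin p → (⊤ : SimpleGraph (Fin m)).edgeSet → ℝ :=
      fun i e => ∑ a ∈ univ.filter (fun a : Fin g.1 => w a = e), B' i a
    have hB : ∀ i e, 0 ≤ B i e := fun i e => Finset.sum_nonneg fun a _ => hB' i a
    have hkey : ∀ (x : (⊤ : SimpleGraph (Fin m)).edgeSet → Bool) (i : Fin p),
        (∑ a, B' i a * (if x (w a) then (1 : ℝ) else 0)) = ∑ e, B i e * (if x e then (1 : ℝ) else 0) := by
      intro x i
      have hind : ∀ a : Fin g.1, (if x (w a) then (1 : ℝ) else 0) =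
          ∑ e, if w a = e then (if x e then (1 : ℝ) else 0) else 0 := fun a => by
        rw [Finset.sum_ite_eq]; simp
      simp_rw [hind, Finset.mul_sum, B, Finset.sum_mul]
      rw [Finset.sum_comm]
      refine Finset.sum_congr rfl fun e _ => ?_
      rw [Finset.sum_filter]
      refine Finset.sum_congr rfl fun a _ => ?_
      split_ifs <;> simp
    refine h p q hpq A b B hB fun x => ?_
    rw [← hcomp x, hiff]
    simp_rw [hkey]

/-- **`ConvexGateBlind` in matrix form.** The crux of route ConvexRankGates is EQUIVALENT to: for some
`δ ∈ (0, 1/2)` and every `c`, eventually no valid certificate system for the `⌈m^δ⌉₊`-clique-free graphs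
of `K_m` (non-negative edge weightings `w_u`, thresholds `θ_u > w_u · u`) has its slack matrix against the
`⌈m^δ⌉₊`-cliques factorised as `w_u · 1_Q - θ_u = tr(H_u Y_Q) + λ_u · s_Q` with `H_u, Y_Q ⪰ 0` (`q × q`),
`λ_u, s_Q ≥ 0` (`r` terms) and `q + r ≤ m^c`. (Collapse `convexGateBlind_iff_oneGate`, wiring
`oneGateHard_iff_dataHard`, and `convDataHard_iff_rankHard`.) [folklore assembly] -/
theorem convexGateBlind_iff_rankHard :
    Summit.PneNP.PneNP.Theses.ConvexRankGates.ConvexGateBlind ↔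
    (∃ δ : ℝ, 0 < δ ∧ δ < 1 / 2 ∧ ∀ c : ℕ, ∀ᶠ m : ℕ in Filter.atTop,
      ∀ (q r : ℕ), q + r ≤ m ^ c →
        ∀ (w : ((⊤ : SimpleGraph (Fin m)).edgeSet → Bool) → (⊤ : SimpleGraph (Fin m)).edgeSet → ℝ)
          (θ : ((⊤ : SimpleGraph (Fin m)).edgeSet → Bool) → ℝ)
          (H : ((⊤ : SimpleGraph (Fin m)).edgeSet → Bool) → Matrix (Fin q) (Fin q) ℝ)
          (lam : ((⊤ : SimpleGraph (Fin m)).edgeSet → Bool) → Fin r → ℝ)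
          (Y : Finset (Fin m) → Matrix (Fin q) (Fin q) ℝ) (s : Finset (Fin m) → Fin r → ℝ),
          (∀ u, cliqueFn m ⌈(m : ℝ) ^ δ⌉₊ u = false → ∀ e, 0 ≤ w u e) →
          (∀ u, cliqueFn m ⌈(m : ℝ) ^ δ⌉₊ u = false →
            ∑ e, w u e * (if u e then (1 : ℝ) else 0) < θ u) →
          (∀ u, cliqueFn m ⌈(m : ℝ) ^ δ⌉₊ u = false → (H u).PosSemidef) →
          (∀ u, cliqueFn m ⌈(m : ℝ) ^ δ⌉₊ u = false → ∀ ℓ, 0 ≤ lam u ℓ) →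
          (∀ Q : Finset (Fin m), Q.card = ⌈(m : ℝ) ^ δ⌉₊ → (Y Q).PosSemidef) →
          (∀ Q : Finset (Fin m), Q.card = ⌈(m : ℝ) ^ δ⌉₊ → ∀ ℓ, 0 ≤ s Q ℓ) →
          ¬ ∀ (Q : Finset (Fin m)) (u : (⊤ : SimpleGraph (Fin m)).edgeSet → Bool),
              Q.card = ⌈(m : ℝ) ^ δ⌉₊ → cliqueFn m ⌈(m : ℝ) ^ δ⌉₊ u = false →
                ∑ e, w u e * (if cliqueVec Q e then (1 : ℝ) else 0) - θ u =
                  (H u * Y Q).trace + ∑ ℓ, lam u ℓ * s Q ℓ) := by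
  rw [convexGateBlind_iff_oneGate, ← convDataHard_iff_rankHard]
  refine exists_congr fun δ => and_congr_right fun _ => and_congr_right fun _ =>
    forall_congr' fun c => Filter.eventually_congr (Filter.Eventually.of_forall fun m => ?_)
  exact oneGateHard_iff_dataHard m ⌈(m : ℝ) ^ δ⌉₊ (m ^ c)

end Summit.PneNP.PneNP.Theorems
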